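import Summits.CriticalPhenomena.SAWScalingLimit.Theorems.SAWReversalUpgradePathUpgradeRRangeBoundAux
import HarnessLib

/-!
# `stub_sleStart` — the SLE reference curve stays near its starting prime end for a short time
(crux `PathUpgradeR`, stmt-CriticalPhenomena-18055, route `SAWReversalUpgrade`,
line `bidir_windows`)

Landing target:
`Summits/CriticalPhenomena/SAWScalingLimit/Theorems/SAWReversalUpgradePathUpgradeRSLEStart.lean`
(`--supports stmt-CriticalPhenomena-18055`; registered stub `stub_sleStart`).

The registered theorem `stub_sleStart` is a quantile lemma for the SLE(8/3) reference sample
`γ = sleTrace (8/3) ω` seen in a Dobrushin domain `E` through the boundary extension `ψ̄` of a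
chordal uniformizer `ψ : ℍ ≃ E` (`ψ̄ 0 = E.pt 0 =: a`): for every radius `ρ > 0` and budget `β > 0`
there is a deterministic time `α₀ > 0` such that the event "`ψ̄ (γ u)` is at distance `≥ ρ` from
`a` for some `u ≤ α₀`" has `P'`-measure at most `β`.

Proof (sub-namespace `PathUpgradeRSLERegStart`, general `κ`): `r := ψ̄ ∘ γ` is continuous with
`r 0 = a` for EVERY sample, so the measurable supersets
`B N := {∃ q ∈ S, q < 2/(N+1), ρ/2 < dist (r q) a}` (`S` a countable dense set of times; marginal
measurability `measurable_sleTrace` and continuity of `ψ̄ ∘ liftIm 0`) decrease to the empty set;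
continuity from above (`tendsto_measure_iInter_atTop`) gives `P' (B N) → 0`, and the event of the
statement with `α₀ := 1/(N+1)` is contained in `B N` by continuity of `r` and density of `S`.
This imitates `PathUpgradeRRangeBound.exists_measure_tail_le`.
-/

noncomputable section

open scoped ENNReal NNReal Topology
open MeasureTheory Filter Set Metric TopologicalSpace
open Literature.Probability Literature.Probability.RandomPlanarGeometry
open UpperHalfPlane (upperHalfPlaneSet)

namespace Summit.CriticalPhenomena.SAWScalingLimit.Theorems

namespace PathUpgradeRSLERegStart

/-- The SLE start: for a chordal uniformizer `φ` of `(D; a, b)`, every `ρ > 0` and `β ≠ 0`, some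
`N` has `P' {∃ t ≤ 1/(N+1), ρ ≤ dist (φ̄ (γ t)) a} ≤ β`. The curve `t ↦ φ̄ (γ t)` is continuous
with value `a` at `t = 0` for every sample, so the measurable supersets
`{∃ q ∈ S, q < 2/(N+1), ρ/2 < dist (φ̄ (γ q)) a}` (`S` countable dense) decrease to `∅`.
[folklore] -/
theorem exists_measure_start_le {κ : ℝ≥0} {D : DobrushinDomain}
    {φ : ConformalEquiv upperHalfPlaneSet D.carrier} (hφ : D.IsChordalUniformizing φ)
    {ρ : ℝ} (hρ : 0 < ρ) {β : ℝ≥0∞} (hβ : β ≠ 0) :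
    ∃ N : ℕ, Process.preWienerMeasure {ω | ∃ t : ℝ≥0, (t : ℝ) ≤ 1 / (N + 1) ∧
      ρ ≤ dist (φ.boundaryExtension (sleTrace κ ω t)) (D.pt 0)} ≤ β := by
  haveI : IsProbabilityMeasure Process.preWienerMeasure := isProbabilityMeasure_preWienerMeasure'
  have hΦc : Continuous fun z ↦ φ.boundaryExtension (Loewner.liftIm 0 z) :=
    continuous_boundaryExtension_liftIm φ
  have hfeq : ∀ (ω : ℝ≥0 → ℝ) (t : ℝ≥0),
      dist (φ.boundaryExtension (Loewner.liftIm 0 (sleTrace κ ω t))) (D.pt 0) =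
        dist (φ.boundaryExtension (sleTrace κ ω t)) (D.pt 0) := fun ω t ↦ by
    rw [Loewner.liftIm_of_le (x := sleTrace κ ω t) (Loewner.trace_im_nonneg (sleDriving κ ω) t)]
  have hfm : ∀ t : ℝ≥0, Measurable fun ω : ℝ≥0 → ℝ ↦
      dist (φ.boundaryExtension (Loewner.liftIm 0 (sleTrace κ ω t))) (D.pt 0) := fun t ↦
    (hΦc.measurable.comp (measurable_sleTrace κ t)).dist measurable_const
  have hfc : ∀ ω : ℝ≥0 → ℝ, Continuous fun t : ℝ≥0 ↦
      dist (φ.boundaryExtension (Loewner.liftIm 0 (sleTrace κ ω t))) (D.pt 0) := fun ω ↦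
    (hΦc.comp (continuous_sleTrace κ ω)).dist continuous_const
  have hf0 : ∀ ω : ℝ≥0 → ℝ,
      dist (φ.boundaryExtension (Loewner.liftIm 0 (sleTrace κ ω 0))) (D.pt 0) = 0 := fun ω ↦ by
    rw [hfeq, sleTrace_zero, hφ.boundaryExtension_zero, dist_self]
  obtain ⟨S, hSc, hSd⟩ := TopologicalSpace.exists_countable_dense ℝ≥0
  obtain ⟨B, hBmem⟩ : ∃ B : ℕ → Set (ℝ≥0 → ℝ), ∀ N ω, ω ∈ B N ↔ ∃ q ∈ S,
      (q : ℝ) < 2 / (N + 1) ∧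
        ρ / 2 < dist (φ.boundaryExtension (Loewner.liftIm 0 (sleTrace κ ω q))) (D.pt 0) :=
    ⟨fun N ↦ {ω | ∃ q ∈ S, (q : ℝ) < 2 / (N + 1) ∧
      ρ / 2 < dist (φ.boundaryExtension (Loewner.liftIm 0 (sleTrace κ ω q))) (D.pt 0)},
      fun _ _ ↦ Iff.rfl⟩
  have hBm : ∀ N, MeasurableSet (B N) := by
    intro N
    have hrep : B N = ⋃ q ∈ {q ∈ S | (q : ℝ) < 2 / (N + 1)},
        {ω | ρ / 2 < dist (φ.boundaryExtension (Loewner.liftIm 0 (sleTrace κ ω q))) (D.pt 0)} := by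
      ext ω
      simp only [hBmem, mem_iUnion, mem_setOf_eq, exists_prop, and_assoc]
    rw [hrep]
    exact MeasurableSet.biUnion (hSc.mono (sep_subset _ _))
      fun q _ ↦ measurableSet_lt measurable_const (hfm q)
  have hanti : Antitone B := fun N N' hNN' ω hω ↦ by
    obtain ⟨q, hqS, hq, hωq⟩ := (hBmem N' ω).1 hω
    refine (hBmem N ω).2 ⟨q, hqS, hq.trans_le ?_, hωq⟩
    gcongr
  have hnull : Process.preWienerMeasure (⋂ N, B N) = 0 := by
    have hempty : (⋂ N, B N) = ∅ := by
      refine eq_empty_of_forall_notMem fun ω hmem ↦ ?_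
      have h0 :
          dist (φ.boundaryExtension (Loewner.liftIm 0 (sleTrace κ ω 0))) (D.pt 0) < ρ / 2 := by
        rw [hf0]
        exact half_pos hρ
      have hev : ∀ᶠ t in 𝓝 (0 : ℝ≥0),
          dist (φ.boundaryExtension (Loewner.liftIm 0 (sleTrace κ ω t))) (D.pt 0) < ρ / 2 :=
        (hfc ω).continuousAt.eventually_lt continuousAt_const h0
      obtain ⟨ε, hε, hball⟩ := Metric.eventually_nhds_iff.1 hev
      obtain ⟨N, hN⟩ := exists_nat_one_div_lt (half_pos hε)
      obtain ⟨q, -, hq, hωq⟩ := (hBmem N ω).1 (mem_iInter.1 hmem N)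
      have hdist : dist q (0 : ℝ≥0) < ε := by
        rw [NNReal.dist_eq, NNReal.coe_zero, sub_zero, NNReal.abs_eq]
        calc (q : ℝ) < 2 / (N + 1) := hq
          _ = 2 * (1 / (N + 1)) := by ring
          _ < 2 * (ε / 2) := by gcongr
          _ = ε := by ring
      exact absurd (hball hdist) (not_lt.2 hωq.le)
    rw [hempty, measure_empty]
  have htend := tendsto_measure_iInter_atTop (μ := Process.preWienerMeasure)
    (fun N ↦ (hBm N).nullMeasurableSet) hanti ⟨0, measure_ne_top _ _⟩
  rw [hnull] at htend
  obtain ⟨N, hN⟩ := (htend.eventually_lt_const (pos_iff_ne_zero.2 hβ)).exists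
  refine ⟨N, (measure_mono ?_).trans hN.le⟩
  rintro ω ⟨t, hNt, hωt⟩
  have hopen : IsOpen {s : ℝ≥0 | (s : ℝ) < 2 / (N + 1) ∧
      ρ / 2 < dist (φ.boundaryExtension (Loewner.liftIm 0 (sleTrace κ ω s))) (D.pt 0)} :=
    (isOpen_lt NNReal.continuous_coe continuous_const).inter
      (isOpen_lt continuous_const (hfc ω))
  have ht2 : (t : ℝ) < 2 / (N + 1) := by
    calc (t : ℝ) ≤ 1 / (N + 1) := hNt
      _ < 2 / (N + 1) := by gcongr; norm_num
  have hρt : ρ / 2 < dist (φ.boundaryExtension (Loewner.liftIm 0 (sleTrace κ ω t))) (D.pt 0) := by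
    rw [hfeq]
    exact (half_lt_self hρ).trans_le hωt
  obtain ⟨q, hqS, hqN, hq⟩ := hSd.exists_mem_open hopen ⟨t, ht2, hρt⟩
  exact (hBmem N ω).2 ⟨q, hqS, hqN, hq⟩

end PathUpgradeRSLERegStart

/-- **SLE start quantile** (registered stub `stub_sleStart` of crux `PathUpgradeR`, line
`bidir_windows`): for the SLE(8/3) reference curve `γ = sleTrace (8/3) ω` seen in the Dobrushin
domain `E` through the boundary extension `ψ̄` of a chordal uniformizer `ψ` (`ψ̄ 0 = E.pt 0`), every
radius `ρ > 0` and budget `β > 0` admit a deterministic time `α₀ > 0` with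
`P' {∃ u ≤ α₀, ρ ≤ dist (ψ̄ (γ u)) (E.pt 0)} ≤ β` (continuity of `ψ̄ ∘ γ` at `0` for every sample
and continuity of the probability measure `P'` from above). [folklore] -/
theorem stub_sleStart : ∀ (E : Literature.Probability.RandomPlanarGeometry.DobrushinDomain) (ψ : Literature.Probability.RandomPlanarGeometry.ConformalEquiv UpperHalfPlane.upperHalfPlaneSet E.carrier), E.IsChordalUniformizing ψ → ∀ ρ : ℝ, 0 < ρ → ∀ β : ENNReal, 0 < β → ∃ α₀ : ℝ, 0 < α₀ ∧ Literature.Probability.Process.preWienerMeasure {ω | ∃ u : NNReal, (u : ℝ) ≤ α₀ ∧ ρ ≤ dist (ψ.boundaryExtension (Literature.Probability.RandomPlanarGeometry.sleTrace ((8:NNReal)/3) ω u)) (E.pt 0)} ≤ β := by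
  intro E ψ hψ ρ hρ β hβ
  obtain ⟨N, hN⟩ :=
    PathUpgradeRSLERegStart.exists_measure_start_le (κ := (8 : ℝ≥0) / 3) hψ hρ hβ.ne'
  exact ⟨1 / (N + 1), by positivity, hN⟩

end Summit.CriticalPhenomena.SAWScalingLimit.Theorems

end
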